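import Summits.KontsevichZagierPeriods.KontsevichZagierPeriods.Theorems.CommonUnfoldingInterchangeLemma
import Literature.NumberTheory.Transcendental.KZUnfolding

/-!
# `KlInterchange` — F3 / BC5 WITNESS (line `Lines/KlInterchange.lean` of crux `PeakNormalForm`,
# stmt-KontsevichZagierPeriods-4828; forward rung G1 over `InterchangeLemma`, seed g1-KontsevichZagierPeriods-4830)

The rung family `KlInterchange k l` instantiated at the FLOOR `(k, l) = (0, 0)` (one band against one
band, bases agreeing with `r₂` on its domain) follows from the seed theorem
`Summit.KontsevichZagierPeriods.CommonUnfolding.interchangeLemma_proof` (stmt-KontsevichZagierPeriods-4830,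
crux 4 of route CommonUnfolding, PROVED) by bookkeeping only: a Newton–Leibniz instance depends on its
base only through the base's domain and the integrand's values there (`nl_base_congr`, repackaging via
the seed file's own `nl_data`), and sums over `Fin 1` collapse. `example : KlInterchange 0 0` below,
no `sorry`. Standalone copy of the definition of `Lines/KlInterchange.lean` (same namespace; the two
files are never imported together); this file deliberately imports only the FLOOR
(`Theorems/CommonUnfoldingInterchangeLemma.lean`), not the landed rung
(`Theorems/CommonUnfoldingPeakNormalFormKlInterchange.lean`, `stub_klInterchange`), so that the witness
is the floor and nothing else. Same-rung guard (probes of the source seat, `bc/Rung_probe.lean` in the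
harvest folder): `floor → Rung` and `floor → KlInterchange 1 0` do NOT close by the cheap batteries.
Witness written by seat fwd-rung-KontsevichZagierPeriods-03 (2026-08-17), published by the harvest seat.
-/

namespace Summit.KontsevichZagierPeriods.KontsevichZagierPeriods.Cruxes.PeakNormalForm.KlInterchange

open Literature.NumberTheory.Transcendental
open Summit.KontsevichZagierPeriods.CommonUnfolding (nl_data interchangeLemma_proof)

/-- The rung family (copied verbatim from `Lines/KlInterchange.lean`; the filed text). -/
def KlInterchange (k l : ℕ) : Prop :=
  ∀ ⦃n : ℕ⦄ (r₂ : KZ.IntegralRep n)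
    (B : Fin (k + 1) → KZ.IntegralRep (n + 1)) (b : Fin (k + 1) → KZ.IntegralRep n)
    (B' : Fin (l + 1) → KZ.IntegralRep (n + 1)) (b' : Fin (l + 1) → KZ.IntegralRep n),
    (∀ i, KZ.of (B i) - KZ.of (b i) ∈ KZ.newtonLeibnizRel) →
    (∀ j, KZ.of (B' j) - KZ.of (b' j) ∈ KZ.newtonLeibnizRel) →
    (∀ i, (b i).domain = r₂.domain) → (∀ j, (b' j).domain = r₂.domain) →
    (∀ x ∈ r₂.domain, ∑ i, (b i).integrand x = r₂.integrand x) →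
    (∀ x ∈ r₂.domain, ∑ j, (b' j).integrand x = r₂.integrand x) →
    (∀ i, ∀ x ∈ r₂.domain, ∃ t t' : ℝ, t < t' ∧
      (Fin.snoc x t : Fin (n + 1) → ℝ) ∈ (B i).domain ∧ (Fin.snoc x t' : Fin (n + 1) → ℝ) ∈ (B i).domain) →
    (∀ j, ∀ x ∈ r₂.domain, ∃ t t' : ℝ, t < t' ∧
      (Fin.snoc x t : Fin (n + 1) → ℝ) ∈ (B' j).domain ∧ (Fin.snoc x t' : Fin (n + 1) → ℝ) ∈ (B' j).domain) →
    ∃ (R R' : Fin (k + 1) → Fin (l + 1) → KZ.IntegralRep (n + 2))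
      (c c' : Fin (k + 1) → Fin (l + 1) → KZ.IntegralRep (n + 1)),
      (∀ i j, KZ.of (R i j) - KZ.of (c i j) ∈ KZ.newtonLeibnizRel) ∧
      (∀ i j, KZ.of (R' i j) - KZ.of (c' i j) ∈ KZ.newtonLeibnizRel) ∧
      (∀ i j, (R' i j).domain =
        (fun w : Fin (n + 2) → ℝ => w ∘ ⇑(Equiv.swap (Fin.castSucc (Fin.last n)) (Fin.last (n + 1)))) ''
          (R i j).domain) ∧
      (∀ i j, ∀ w ∈ (R i j).domain, (R i j).integrand w =
        (R' i j).integrand (w ∘ ⇑(Equiv.swap (Fin.castSucc (Fin.last n)) (Fin.last (n + 1))))) ∧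
      (∀ i j, (c i j).domain = (B i).domain) ∧ (∀ i j, (c' i j).domain = (B' j).domain) ∧
      (∀ i, ∀ z ∈ (B i).domain, ∑ j, (c i j).integrand z = (B i).integrand z) ∧
      (∀ j, ∀ z ∈ (B' j).domain, ∑ i, (c' i j).integrand z = (B' j).integrand z)

/-- Same text as the line file: the definition here and in `Lines/KlInterchange.lean` agree verbatim. -/
example : KlInterchange = fun k l => ∀ ⦃n : ℕ⦄ (r₂ : KZ.IntegralRep n)
    (B : Fin (k + 1) → KZ.IntegralRep (n + 1)) (b : Fin (k + 1) → KZ.IntegralRep n)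
    (B' : Fin (l + 1) → KZ.IntegralRep (n + 1)) (b' : Fin (l + 1) → KZ.IntegralRep n),
    (∀ i, KZ.of (B i) - KZ.of (b i) ∈ KZ.newtonLeibnizRel) →
    (∀ j, KZ.of (B' j) - KZ.of (b' j) ∈ KZ.newtonLeibnizRel) →
    (∀ i, (b i).domain = r₂.domain) → (∀ j, (b' j).domain = r₂.domain) →
    (∀ x ∈ r₂.domain, ∑ i, (b i).integrand x = r₂.integrand x) →
    (∀ x ∈ r₂.domain, ∑ j, (b' j).integrand x = r₂.integrand x) →
    (∀ i, ∀ x ∈ r₂.domain, ∃ t t' : ℝ, t < t' ∧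
      (Fin.snoc x t : Fin (n + 1) → ℝ) ∈ (B i).domain ∧ (Fin.snoc x t' : Fin (n + 1) → ℝ) ∈ (B i).domain) →
    (∀ j, ∀ x ∈ r₂.domain, ∃ t t' : ℝ, t < t' ∧
      (Fin.snoc x t : Fin (n + 1) → ℝ) ∈ (B' j).domain ∧ (Fin.snoc x t' : Fin (n + 1) → ℝ) ∈ (B' j).domain) →
    ∃ (R R' : Fin (k + 1) → Fin (l + 1) → KZ.IntegralRep (n + 2))
      (c c' : Fin (k + 1) → Fin (l + 1) → KZ.IntegralRep (n + 1)),
      (∀ i j, KZ.of (R i j) - KZ.of (c i j) ∈ KZ.newtonLeibnizRel) ∧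
      (∀ i j, KZ.of (R' i j) - KZ.of (c' i j) ∈ KZ.newtonLeibnizRel) ∧
      (∀ i j, (R' i j).domain =
        (fun w : Fin (n + 2) → ℝ => w ∘ ⇑(Equiv.swap (Fin.castSucc (Fin.last n)) (Fin.last (n + 1)))) ''
          (R i j).domain) ∧
      (∀ i j, ∀ w ∈ (R i j).domain, (R i j).integrand w =
        (R' i j).integrand (w ∘ ⇑(Equiv.swap (Fin.castSucc (Fin.last n)) (Fin.last (n + 1))))) ∧
      (∀ i j, (c i j).domain = (B i).domain) ∧ (∀ i j, (c' i j).domain = (B' j).domain) ∧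
      (∀ i, ∀ z ∈ (B i).domain, ∑ j, (c i j).integrand z = (B i).integrand z) ∧
      (∀ j, ∀ z ∈ (B' j).domain, ∑ i, (c' i j).integrand z = (B' j).integrand z) := rfl

/-- Repackaging: a Newton–Leibniz instance `[B] − [b]` depends on the base `b` only through
`b.domain` and the values of `b.integrand` there. [Kontsevich–Zagier 2001, §1.2 rule 3)]
[folklore] -/
theorem nl_base_congr {n : ℕ} {B : KZ.IntegralRep (n + 1)} {b r : KZ.IntegralRep n}
    (h : KZ.of B - KZ.of b ∈ KZ.newtonLeibnizRel) (hd : b.domain = r.domain)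
    (hi : ∀ x ∈ r.domain, b.integrand x = r.integrand x) :
    KZ.of B - KZ.of r ∈ KZ.newtonLeibnizRel := by
  obtain ⟨a, c, F, hF, ha, hc, hle, hband, hcont, hderiv, hbase⟩ := nl_data h
  rw [hd] at ha hc hle hband hcont hderiv hbase
  refine ⟨n, B, r, a, c, F, hF, ha, hc, hle, hband, hcont, hderiv, fun x hx => ?_, rfl⟩
  rw [← hi x hx]
  exact hbase x hx

/-- **F3 / BC5 witness.** The floor is the rung at `(k, l) = (0, 0)`:
`KlInterchange 0 0` from `interchangeLemma_proof` (stmt-4830). -/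
theorem klInterchange_zero_zero : KlInterchange 0 0 := by
  intro n r₂ B b B' b' hB hB' hd hd' hs hs' hne hne'
  have h1 : KZ.of (B 0) - KZ.of r₂ ∈ KZ.newtonLeibnizRel :=
    nl_base_congr (hB 0) (hd 0) fun x hx => by simpa using hs x hx
  have h3 : KZ.of (B' 0) - KZ.of r₂ ∈ KZ.newtonLeibnizRel :=
    nl_base_congr (hB' 0) (hd' 0) fun x hx => by simpa using hs' x hx
  obtain ⟨R, R', hR, hR', hdom, hint⟩ := interchangeLemma_proof r₂ (B 0) (B' 0) h1 h3 (hne 0) (hne' 0)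
  refine ⟨fun _ _ => R, fun _ _ => R', fun i _ => B i, fun _ j => B' j, fun i j => ?_, fun i j => ?_,
    fun _ _ => hdom, fun _ _ => hint, fun _ _ => rfl, fun _ _ => rfl, fun i z _ => by simp,
    fun j z _ => by simp⟩
  · rw [Fin.fin_one_eq_zero i]; exact hR
  · rw [Fin.fin_one_eq_zero j]; exact hR'

/-- The F3 line in the brief's literal shape. -/
example : KlInterchange 0 0 := klInterchange_zero_zero

end Summit.KontsevichZagierPeriods.KontsevichZagierPeriods.Cruxes.PeakNormalForm.KlInterchange
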